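import Mathlib
import Summits.KontsevichZagierPeriods.KontsevichZagierPeriods.Theses.UnfoldedStokes

/-!
# Route UnfoldedStokes — support item `LegendreGlue`

`LegendreAllModuli → LegendreLemniscatic`: Legendre's relation `E K′ + E′ K − K K′ = π/2` in the
all-moduli interval form (route decl `LegendreAllModuli`), specialised at the lemniscatic modulus
`k = √(1/2)` (so `k′ = k`, `K′ = K`, `E′ = E`), is verbatim the `k² = 1/2` instance
`2 E K − K² = π/2` (route decl `LegendreLemniscatic`, the statement of Grothendieck item
`GpcLegendreLemniscatic`).  Pure glue: `k` is algebraic (a root of `X² − 1/2`), `0 < k < 1`, and the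
two integrands agree pointwise on `(0,1)²` by real arithmetic after `k² = 1 − k² = 1/2`.

Source of the relation: Kontsevich–Zagier, *Periods* (2001), §1.1 (Legendre's relation as the
model accessible identity); the specialisation itself is elementary.
-/

-- `Summit.<Summit>.<Sub>` with Sub = Summit (single-conjunct summit, D-0017) duplicates the segment.
set_option linter.dupNamespace false

namespace Summit.KontsevichZagierPeriods.KontsevichZagierPeriods.Theorems

open Summit.KontsevichZagierPeriods.KontsevichZagierPeriods.Theses.UnfoldedStokes

/-- The lemniscatic modulus `√(1/2)` squares to `1/2`. -/
private lemma sqrt_half_sq : Real.sqrt (1 / 2) ^ 2 = 1 / 2 :=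
  Real.sq_sqrt (by norm_num)

/-- The lemniscatic modulus `√(1/2)` is algebraic over `ℚ` (a root of `X² − 1/2`). -/
private lemma isAlgebraic_sqrt_half : IsAlgebraic ℚ (Real.sqrt (1 / 2)) := by
  refine ⟨Polynomial.X ^ 2 - Polynomial.C (1 / 2 : ℚ), ?_, ?_⟩
  · exact Polynomial.X_pow_sub_C_ne_zero (by norm_num) _
  · simp only [map_sub, map_pow, Polynomial.aeval_X, Polynomial.aeval_C, sqrt_half_sq]
    simp

/-- **Support item `LegendreGlue`** (stmt-KontsevichZagierPeriods-3524): the all-moduli Legendre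
relation `LegendreAllModuli` specialised at `k = √(1/2)` gives the lemniscatic instance
`LegendreLemniscatic`.  Proof: `k` is algebraic with `0 < k < 1` and `k² = 1 − k² = 1/2`, and the
integrand `e_k κ_{k′} + e_{k′} κ_k − κ_k κ_{k′}` collapses pointwise to `2 e κ − κ κ`. -/
theorem legendreGlue_proof :
    Summit.KontsevichZagierPeriods.KontsevichZagierPeriods.Theses.UnfoldedStokes.LegendreGlue := by
  unfold LegendreGlue
  intro hAll r r' hdom hint hdom' hint'
  have hk2 : Real.sqrt (1 / 2) ^ 2 = 1 / 2 := sqrt_half_sq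
  have hk0 : 0 < Real.sqrt (1 / 2) := Real.sqrt_pos.mpr (by norm_num)
  have hk1 : Real.sqrt (1 / 2) < 1 := by
    rw [Real.sqrt_lt' one_pos]
    norm_num
  refine hAll (Real.sqrt (1 / 2)) isAlgebraic_sqrt_half hk0 hk1 r r' hdom ?_ hdom' hint'
  intro x hx
  rw [hint hx]
  have h1 : ∀ y : ℝ, 1 - (1 - Real.sqrt (1 / 2) ^ 2) * y ^ 2 = 1 - y ^ 2 / 2 := fun y => by
    rw [hk2]; ring
  have h2 : ∀ y : ℝ, 1 - Real.sqrt (1 / 2) ^ 2 * y ^ 2 = 1 - y ^ 2 / 2 := fun y => by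
    rw [hk2]; ring
  simp only [h1, h2]
  ring

end Summit.KontsevichZagierPeriods.KontsevichZagierPeriods.Theorems
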